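import Summits.CriticalPhenomena.CardyFormulaZ2.Theorems.CardyIKTransportIKLinearTransportLine
import Literature.Probability.LatticeModels.ProdBernoulliIndependence
import Literature.Probability.Percolation.SitePercolationMeasure

/-!
# Stub `stub_ConditionalRSW` (crux stmt-CriticalPhenomena-5076, line `pinned-diagram-exchange`):
# finite energy of the column-mixed IK gauge, I — flips of the gauge bits

Helpers toward the registered stub `stub_ConditionalRSW` (conditional RSW, uniform in the column pattern
`S`). The colour `blackSet S ω ∋ v` is `ω.1 (v 0) ⊕ ω.2.1 (v 1) ⊕ parity of the plaquettes in the
anchoring rectangle [min 0 v₀, max 0 v₀) × [min 0 v₁, max 0 v₁)`. This file proves, for three families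
of bit flips of `Ω`, a SPECIFICATION "measurable ∧ `μIK ∘ Φ⁻¹ ≤ K • μIK` ∧ coins fixed ∧ toggles the
colour of `v` iff `P v`, for every `S`" (`rowFlip_spec`, `colFlip_spec`, `faceFlip_spec`): flipping
the row signs along any `T ⊆ ℤ` (`K = 1`, `P v = (v 0 ∈ T)`; fair bits: `crsw_sitePercolation_half_map_symmDiff`
via `Measure.infinitePi_map_pi`), the column signs (`K = 1`), and ONE plaquette `g` in both plaquette
fields (`K = min(q,1-q)⁻¹ < ∞`, `q = 2√3 - 3`, `P v = (g ∈ rectangle of v)`; one-site splitting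
`crsw_sitePercolation_real_split` from the tree's `prodBernoulli_real_inter_of_determinedBy`). The companion
files `…StubConditionalRSWCells` (single-cell flips: the four plaquettes around `c`, plus the axis sign
bits — at the origin infinitely many fair bits) and `…StubConditionalRSWFiniteEnergy` (the conditional
bound `CondRSWBound c_n S n a b E` at every fixed scale `n`, all `S`) consume these specifications as
hypotheses; the uniformity of `c` in `n` is the RSW content of the stub (route item stmt-5911).
-/

noncomputable section

namespace Summit.CriticalPhenomena.CardyFormulaZ2.Theorems.IKLinearTransport.PinnedDiagramExchange

open scoped BigOperators Classical MeasureTheory ProbabilityTheory ENNReal symmDiff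
open Set Function MeasureTheory
open Literature.Probability.Percolation Literature.Probability.LatticeModels

/-! ## §A Flipping coordinates of Bernoulli site percolation -/

/-- `S ↦ S ∆ T` is measurable. [folklore] -/
theorem crsw_measurable_symmDiff_right {V : Type*} (T : Set V) : Measurable fun S : Set V => S ∆ T := by
  refine measurable_set_iff.2 fun v => ?_
  by_cases hv : v ∈ T
  · have : (fun S : Set V => v ∈ S ∆ T) = fun S => v ∉ S := by funext S; simp [Set.mem_symmDiff, hv]
    rw [this]; exact (measurable_set_mem v).not
  · have : (fun S : Set V => v ∈ S ∆ T) = fun S => v ∈ S := by funext S; simp [Set.mem_symmDiff, hv]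
    rw [this]; exact measurable_set_mem v

/-- Fair site percolation is invariant under flipping any fixed set of coordinates. [folklore] -/
theorem crsw_sitePercolation_half_map_symmDiff {V : Type*} (T : Set V) :
    (sitePercolation V half).map (fun S : Set V => S ∆ T) = sitePercolation V half := by
  have hf : ∀ v : V, Measurable (fun a : Prop => Xor a (v ∈ T)) := fun v => measurable_from_top
  have hpi : Measurable fun (χ : V → Prop) (v : V) => Xor (χ v) (v ∈ T) :=
    measurable_pi_lambda _ fun v => (hf v).comp (measurable_pi_apply v)
  rw [sitePercolation_eq_map, Measure.map_map (crsw_measurable_symmDiff_right T) measurable_setOf]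
  have hcomp : (fun S : Set V => S ∆ T) ∘ (fun χ : V → Prop => {v | χ v}) =
      (fun χ : V → Prop => {v | χ v}) ∘ (fun (χ : V → Prop) (v : V) => Xor (χ v) (v ∈ T)) := by
    funext χ; ext v; simp [Set.mem_symmDiff, xor_def]
  rw [hcomp, ← Measure.map_map measurable_setOf hpi]
  congr 1
  rw [sitePi, Measure.infinitePi_map_pi (μ := fun _ : V => bernoulliProp half)
    (f := fun (v : V) (a : Prop) => Xor a (v ∈ T)) hf]
  congr 1; funext v
  by_cases hv : v ∈ T
  · have hnot : (fun a : Prop => Xor a (v ∈ T)) = Not := by funext a; simp [hv, xor_def]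
    have hs : unitInterval.symm half = half := Subtype.ext (by simp [half]; norm_num)
    rw [hnot, bernoulliProp, ProbabilityTheory.map_bernoulliMeasure' _ _ measurable_from_top,
      ProbabilityTheory.bernoulliMeasure_def, ProbabilityTheory.bernoulliMeasure_def, hs, add_comm]
    simp
  · have hid : (fun a : Prop => Xor a (v ∈ T)) = id := by funext a; simp [hv, xor_def]
    rw [hid, Measure.map_id]

/-- PRODUCT RULE: `μ ∘ f⁻¹ ≤ K₁ μ`, `ν ∘ g⁻¹ ≤ K₂ ν` give `(μ ⊗ ν) ∘ (f × g)⁻¹ ≤ K₁ K₂ (μ ⊗ ν)`. [folklore] -/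
theorem crsw_map_prodMap_le {α β : Type*} [MeasurableSpace α] [MeasurableSpace β] {μ : Measure α}
    {ν : Measure β} [SFinite μ] [SFinite ν] {f : α → α} {g : β → β} (hf : Measurable f)
    (hg : Measurable g) {K₁ K₂ : ℝ≥0∞} (h₁ : μ.map f ≤ K₁ • μ) (h₂ : ν.map g ≤ K₂ • ν) :
    (μ.prod ν).map (Prod.map f g) ≤ (K₁ * K₂) • μ.prod ν := by
  rw [← Measure.map_prod_map _ _ hf hg]
  calc (μ.map f).prod (ν.map g) ≤ (K₁ • μ).prod (K₂ • ν) := Measure.prod_mono h₁ h₂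
    _ = (K₁ * K₂) • μ.prod ν := by
        rw [Measure.prod_smul_left, Measure.prod_smul_right, smul_smul]

/-- A measure-preserving map has quasi-invariance constant `1`. [folklore] -/
theorem crsw_map_le_one_smul_of_eq {α : Type*} [MeasurableSpace α] {μ : Measure α} {f : α → α}
    (h : μ.map f = μ) : μ.map f ≤ (1 : ℝ≥0∞) • μ := by
  rw [h, one_smul]

/-! ### One-site flips at a general density -/

/-- `insert x` is measurable on site configurations. [folklore] -/
theorem crsw_measurable_insert_site {V : Type*} (x : V) : Measurable fun S : Set V => insert x S := by
  refine measurable_set_iff.2 fun v => ?_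
  have : (fun S : Set V => v ∈ insert x S) = fun S => v = x ∨ v ∈ S := by funext S; simp [Set.mem_insert_iff]
  rw [this]; exact measurable_const.or (measurable_set_mem v)

/-- `· \ {x}` is measurable on site configurations. [folklore] -/
theorem crsw_measurable_sdiff_site {V : Type*} (x : V) : Measurable fun S : Set V => S \ {x} := by
  refine measurable_set_iff.2 fun v => ?_
  have : (fun S : Set V => v ∈ S \ {x}) = fun S => v ∈ S ∧ v ≠ x := by funext S; simp
  rw [this]; exact (measurable_set_mem v).and measurable_const

/-- An event read after inserting `x` is determined by the other sites. [folklore] -/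
theorem crsw_determinedBy_preimage_insert {V : Type*} (x : V) (U : Set (Set V)) :
    DeterminedBy ((fun S : Set V => insert x S) ⁻¹' U) (↑({x} : Finset V) : Set V)ᶜ := by
  rw [determinedBy_iff]
  intro ω ω' h
  have key : insert x ω = insert x ω' := by
    ext v
    by_cases hv : v = x
    · simp [hv]
    · have h' := Set.ext_iff.1 h v
      simp only [Set.mem_inter_iff, Set.mem_compl_iff, Finset.coe_singleton, Set.mem_singleton_iff,
        hv, not_false_eq_true, and_true] at h'
      simp [Set.mem_insert_iff, hv, h']
  simp only [Set.mem_preimage, key]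

/-- An event read after deleting `x` is determined by the other sites. [folklore] -/
theorem crsw_determinedBy_preimage_sdiff {V : Type*} (x : V) (U : Set (Set V)) :
    DeterminedBy ((fun S : Set V => S \ {x}) ⁻¹' U) (↑({x} : Finset V) : Set V)ᶜ := by
  rw [determinedBy_iff]
  intro ω ω' h
  have key : ω \ {x} = ω' \ {x} := by
    ext v
    by_cases hv : v = x
    · simp [hv]
    · have h' := Set.ext_iff.1 h v
      simp only [Set.mem_inter_iff, Set.mem_compl_iff, Finset.coe_singleton, Set.mem_singleton_iff,
        hv, not_false_eq_true, and_true] at h'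
      simp [hv, h']
  simp only [Set.mem_preimage, key]

/-- The state of `x` is determined by `{x}`. [folklore] -/
theorem crsw_determinedBy_mem_site {V : Type*} (x : V) :
    DeterminedBy {S : Set V | x ∈ S} (↑({x} : Finset V) : Set V) := by
  rw [determinedBy_iff]; intro ω ω' h; have h' := Set.ext_iff.1 h x
  simp only [Set.mem_inter_iff, Finset.coe_singleton, Set.mem_singleton_iff, and_true] at h'
  exact h'

/-- Complements of determined events are determined by the same sites. [folklore] -/
theorem crsw_determinedBy_compl' {V : Type*} {A : Set (Set V)} {F : Set V} (h : DeterminedBy A F) :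
    DeterminedBy Aᶜ F := fun χ χ' hF => by
  have e : ({i | χ i} ∈ A) = ({i | χ' i} ∈ A) := h hF
  simp only [Set.mem_compl_iff, e]

/-- SPLITTING AT ONE SITE: `P_q(W) = q · P_q(insert x ⁻¹' W) + (1 - q) · P_q((· \ {x}) ⁻¹' W)`. [folklore] -/
theorem crsw_sitePercolation_real_split {V : Type*} (q : unitInterval) (x : V) {W : Set (Set V)}
    (hW : MeasurableSet W) :
    (sitePercolation V q).real W =
      (q : ℝ) * (sitePercolation V q).real ((fun S : Set V => insert x S) ⁻¹' W) +
        (1 - q) * (sitePercolation V q).real ((fun S : Set V => S \ {x}) ⁻¹' W) := by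
  have hμ : sitePercolation V q = prodBernoulli fun _ : V => q := by rw [prodBernoulli_const]; rfl
  have hmx : MeasurableSet {S : Set V | x ∈ S} := measurableSet_setOf.2 (measurable_set_mem x)
  have h1 : W ∩ {S | x ∈ S} = {S : Set V | x ∈ S} ∩ (fun S : Set V => insert x S) ⁻¹' W := by
    ext S
    simp only [Set.mem_inter_iff, Set.mem_setOf_eq, Set.mem_preimage]
    constructor
    · rintro ⟨hS, hx⟩; exact ⟨hx, by rwa [Set.insert_eq_of_mem hx]⟩
    · rintro ⟨hx, hS⟩; exact ⟨by rwa [Set.insert_eq_of_mem hx] at hS, hx⟩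
  have h2 : W \ {S | x ∈ S} = {S : Set V | x ∈ S}ᶜ ∩ (fun S : Set V => S \ {x}) ⁻¹' W := by
    ext S
    simp only [Set.mem_sdiff, Set.mem_setOf_eq, Set.mem_inter_iff, Set.mem_compl_iff, Set.mem_preimage]
    constructor
    · rintro ⟨hS, hx⟩; exact ⟨hx, by rwa [Set.sdiff_singleton_eq_self hx]⟩
    · rintro ⟨hx, hS⟩; exact ⟨by rwa [Set.sdiff_singleton_eq_self hx] at hS, hx⟩
  have i1 := prodBernoulli_real_inter_of_determinedBy (fun _ : V => q) {x} (crsw_determinedBy_mem_site x)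
    (crsw_determinedBy_preimage_insert x W) hmx (crsw_measurable_insert_site x hW)
  have i2 := prodBernoulli_real_inter_of_determinedBy (fun _ : V => q) {x}
    (crsw_determinedBy_compl' (crsw_determinedBy_mem_site x)) (crsw_determinedBy_preimage_sdiff x W) hmx.compl
    (crsw_measurable_sdiff_site x hW)
  rw [← hμ] at i1 i2
  rw [← measureReal_inter_add_sdiff (μ := sitePercolation V q) (s := W) hmx, h1, h2, i1, i2,
    probReal_compl_eq_one_sub hmx, sitePercolation_real_mem]

/-- ONE-SITE FLIP BOUND: `min(q, 1-q) · P_q(flip_x⁻¹ U) ≤ P_q(U)`. [folklore] -/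
theorem crsw_sitePercolation_real_preimage_flip_le {V : Type*} (q : unitInterval) (x : V)
    {U : Set (Set V)} (hU : MeasurableSet U) :
    min (q : ℝ) (1 - q) * (sitePercolation V q).real ((fun S : Set V => S ∆ {x}) ⁻¹' U) ≤
      (sitePercolation V q).real U := by
  have hfU : MeasurableSet ((fun S : Set V => S ∆ {x}) ⁻¹' U) := crsw_measurable_symmDiff_right {x} hU
  have hins : (fun S : Set V => insert x S) ⁻¹' ((fun S : Set V => S ∆ {x}) ⁻¹' U) =
      (fun S : Set V => S \ {x}) ⁻¹' U := by
    ext S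
    simp only [Set.mem_preimage]
    have : insert x S ∆ {x} = S \ {x} := by
      ext v; by_cases hv : v = x <;> simp [Set.mem_symmDiff, hv]
    rw [this]
  have hdel : (fun S : Set V => S \ {x}) ⁻¹' ((fun S : Set V => S ∆ {x}) ⁻¹' U) =
      (fun S : Set V => insert x S) ⁻¹' U := by
    ext S
    simp only [Set.mem_preimage]
    have : (S \ {x}) ∆ {x} = insert x S := by
      ext v; by_cases hv : v = x <;> simp [hv]
    rw [this]
  rw [crsw_sitePercolation_real_split q x hfU, crsw_sitePercolation_real_split q x hU, hins, hdel]
  set A := (sitePercolation V q).real ((fun S : Set V => insert x S) ⁻¹' U)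
  set B := (sitePercolation V q).real ((fun S : Set V => S \ {x}) ⁻¹' U)
  have hA : 0 ≤ A := measureReal_nonneg
  have hB : 0 ≤ B := measureReal_nonneg
  have hq0 : 0 ≤ (q : ℝ) := q.2.1
  have hq1 : (q : ℝ) ≤ 1 := q.2.2
  have e1 : 0 ≤ ((q : ℝ) - min (q : ℝ) (1 - q)) * ((1 - q) * A) :=
    mul_nonneg (sub_nonneg.2 (min_le_left _ _)) (mul_nonneg (sub_nonneg.2 hq1) hA)
  have e2 : 0 ≤ (q : ℝ) * ((q : ℝ) * A) := mul_nonneg hq0 (mul_nonneg hq0 hA)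
  have e3 : 0 ≤ ((1 - (q : ℝ)) - min (q : ℝ) (1 - q)) * ((q : ℝ) * B) :=
    mul_nonneg (sub_nonneg.2 (min_le_right _ _)) (mul_nonneg hq0 hB)
  have e4 : 0 ≤ (1 - (q : ℝ)) * ((1 - q) * B) := mul_nonneg (sub_nonneg.2 hq1) (mul_nonneg (sub_nonneg.2 hq1) hB)
  nlinarith [e1, e2, e3, e4]

/-- ONE-SITE FLIP BOUND, measure form: `P_q ∘ flip_x⁻¹ ≤ min(q,1-q)⁻¹ · P_q`. [folklore] -/
theorem crsw_sitePercolation_map_flip_le {V : Type*} (q : unitInterval) (hq : 0 < min (q : ℝ) (1 - q))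
    (x : V) :
    (sitePercolation V q).map (fun S : Set V => S ∆ {x}) ≤
      (ENNReal.ofReal (min (q : ℝ) (1 - q)))⁻¹ • sitePercolation V q := by
  refine Measure.le_iff.2 fun U hU => ?_
  have key : (sitePercolation V q).real ((fun S : Set V => S ∆ {x}) ⁻¹' U) ≤
      (min (q : ℝ) (1 - q))⁻¹ * (sitePercolation V q).real U := by
    rw [← div_eq_inv_mul, le_div_iff₀ hq, mul_comm]
    exact crsw_sitePercolation_real_preimage_flip_le q x hU
  have e1 : sitePercolation V q ((fun S : Set V => S ∆ {x}) ⁻¹' U) =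
      ENNReal.ofReal ((sitePercolation V q).real ((fun S : Set V => S ∆ {x}) ⁻¹' U)) :=
    (ofReal_measureReal (measure_ne_top _ _)).symm
  have e2 : sitePercolation V q U = ENNReal.ofReal ((sitePercolation V q).real U) :=
    (ofReal_measureReal (measure_ne_top _ _)).symm
  rw [Measure.map_apply (crsw_measurable_symmDiff_right {x}) hU, Measure.smul_apply, smul_eq_mul, e1, e2,
    ← ENNReal.ofReal_inv_of_pos hq, ← ENNReal.ofReal_mul (inv_nonneg.2 hq.le)]
  exact ENNReal.ofReal_le_ofReal key

/-! ## §B Flips of the gauge bits: row signs, column signs, plaquettes -/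

/-- The biased plaquette density `q = 2√3 - 3` of `μIK` lies strictly inside `(0, 1)`. [folklore] -/
theorem crsw_qIK_min_pos :
    0 < min ((Set.projIcc (0 : ℝ) 1 zero_le_one (2 * Real.sqrt 3 - 3) : ℝ))
      (1 - (Set.projIcc (0 : ℝ) 1 zero_le_one (2 * Real.sqrt 3 - 3) : ℝ)) := by
  have h3 : (3 / 2 : ℝ) < Real.sqrt 3 := by
    rw [Real.lt_sqrt (by norm_num)]; norm_num
  have h4 : Real.sqrt 3 < 2 := by
    rw [Real.sqrt_lt' (by norm_num)]; norm_num
  have hmem : (2 * Real.sqrt 3 - 3 : ℝ) ∈ Set.Icc (0 : ℝ) 1 := ⟨by linarith, by linarith⟩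
  rw [Set.projIcc_of_mem zero_le_one hmem]
  exact lt_min (by simp only; linarith) (by simp only; linarith)

/-- Flipping the face `g` in both plaquette fields flips exactly the parity of `g`, whatever `S`. [folklore] -/
theorem crsw_parSet_faceFlip (S : Set ℤ) (g : Site 2) (ω : Ω) :
    parSet S ((ω.1, ω.2.1, ω.2.2.1 ∆ {g}, ω.2.2.2.1 ∆ {g}, ω.2.2.2.2) : Ω) = parSet S ω ∆ {g} := by
  ext f
  simp only [parSet, Set.mem_setOf_eq, Set.mem_symmDiff, Set.mem_singleton_iff]
  by_cases h : f 0 ∈ S <;> simp [h]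

/-- Exclusive-or bookkeeping. [folklore] -/
theorem crsw_xor_symmDiff_aux (a t r : Prop) : Xor (a ∧ ¬t ∨ t ∧ ¬a) r ↔ Xor (Xor a r) t := by
  grind

/-- A row-sign flip toggles the colours of the cells `v` with `v 0 ∈ T`. [folklore] -/
theorem crsw_mem_blackSet_rowFlip (S T : Set ℤ) (ω : Ω) (v : Site 2) :
    v ∈ blackSet S ((ω.1 ∆ T, ω.2) : Ω) ↔ Xor (v ∈ blackSet S ω) (v 0 ∈ T) := by
  have hp : parSet S ((ω.1 ∆ T, ω.2) : Ω) = parSet S ω := rfl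
  simp only [blackSet, Set.mem_setOf_eq, hp, Set.mem_symmDiff]
  exact crsw_xor_symmDiff_aux _ _ _

/-- Exclusive-or bookkeeping. [folklore] -/
theorem crsw_xor_symmDiff_aux' (a b t r : Prop) : Xor a (Xor (b ∧ ¬t ∨ t ∧ ¬b) r) ↔ Xor (Xor a (Xor b r)) t := by
  grind

/-- A column-sign flip toggles the colours of the cells `v` with `v 1 ∈ T`. [folklore] -/
theorem crsw_mem_blackSet_colFlip (S T : Set ℤ) (ω : Ω) (v : Site 2) :
    v ∈ blackSet S ((ω.1, ω.2.1 ∆ T, ω.2.2) : Ω) ↔ Xor (v ∈ blackSet S ω) (v 1 ∈ T) := by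
  have hp : parSet S ((ω.1, ω.2.1 ∆ T, ω.2.2) : Ω) = parSet S ω := rfl
  simp only [blackSet, Set.mem_setOf_eq, hp, Set.mem_symmDiff]
  exact crsw_xor_symmDiff_aux' _ _ _ _

/-- Parity of a filter by a symmetric difference. [folklore] -/
theorem crsw_odd_card_filter_symmDiff (R : Finset (ℤ × ℤ)) (P Q : Set (Site 2)) :
    Odd (R.filter (fun f : ℤ × ℤ => (![f.1, f.2] : Site 2) ∈ P ∆ Q)).card ↔
      Xor (Odd (R.filter (fun f : ℤ × ℤ => (![f.1, f.2] : Site 2) ∈ P)).card)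
        (Odd (R.filter (fun f : ℤ × ℤ => (![f.1, f.2] : Site 2) ∈ Q)).card) := by
  induction R using Finset.induction_on with
  | empty => simp
  | insert a R ha ih =>
    simp only [Finset.filter_insert, Set.mem_symmDiff]
    by_cases hP : (![a.1, a.2] : Site 2) ∈ P <;> by_cases hQ : (![a.1, a.2] : Site 2) ∈ Q <;>
      simp only [hP, hQ, not_true_eq_false, not_false_eq_true, and_true, and_false, or_false,
        false_or, or_self, if_true, if_false, Finset.card_insert_of_notMem
          (fun h => ha (Finset.mem_filter.1 h).1), Nat.odd_add_one] <;>
      grind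

/-- The single face `g` lies in the anchoring rectangle of the cell `v` (stated for a set `Q = {g}`
so that the classical decidability instance of the filter matches its uses). [folklore] -/
theorem crsw_odd_card_filter_singleton (v g : Site 2) {Q : Set (Site 2)} (hQ : Q = {g}) :
    Odd ((Finset.Ico (min 0 (v 0)) (max 0 (v 0)) ×ˢ Finset.Ico (min 0 (v 1)) (max 0 (v 1))).filter
        (fun f : ℤ × ℤ => (![f.1, f.2] : Site 2) ∈ Q)).card ↔
      (min 0 (v 0) ≤ g 0 ∧ g 0 < max 0 (v 0)) ∧ (min 0 (v 1) ≤ g 1 ∧ g 1 < max 0 (v 1)) := by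
  have hpred : ∀ f : ℤ × ℤ, ((![f.1, f.2] : Site 2) ∈ Q) ↔ f = (g 0, g 1) := by
    intro f
    rw [hQ, Set.mem_singleton_iff]
    constructor
    · intro h
      have h0 := congrFun h 0
      have h1 := congrFun h 1
      simp only [Matrix.cons_val_zero, Matrix.cons_val_one, Matrix.cons_val_fin_one] at h0 h1
      exact Prod.ext h0 h1
    · rintro rfl
      ext i; fin_cases i <;> rfl
  rw [Finset.filter_congr (fun f _ => hpred f), Finset.filter_eq']
  split_ifs with hmem
  · simp only [Finset.card_singleton, odd_one, true_iff]
    simpa [Finset.mem_product, Finset.mem_Ico] using hmem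
  · simp only [Finset.card_empty, Nat.not_odd_zero, false_iff]
    intro h
    exact hmem (by simpa [Finset.mem_product, Finset.mem_Ico] using h)

/-- Exclusive-or bookkeeping. [folklore] -/
theorem crsw_xor_assoc_aux (a b c t : Prop) : Xor a (Xor b (Xor c t)) ↔ Xor (Xor a (Xor b c)) t := by
  grind

/-- A PLAQUETTE FLIP at the face `g` toggles the colour of the cell `v` iff `g` lies in the anchoring
rectangle `[min 0 v₀, max 0 v₀) × [min 0 v₁, max 0 v₁)` of `v`. [folklore] -/
theorem crsw_mem_blackSet_faceFlip (S : Set ℤ) (g : Site 2) (ω : Ω) (v : Site 2) :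
    v ∈ blackSet S ((ω.1, ω.2.1, ω.2.2.1 ∆ {g}, ω.2.2.2.1 ∆ {g}, ω.2.2.2.2) : Ω) ↔
      Xor (v ∈ blackSet S ω)
        ((min 0 (v 0) ≤ g 0 ∧ g 0 < max 0 (v 0)) ∧ (min 0 (v 1) ≤ g 1 ∧ g 1 < max 0 (v 1))) := by
  simp only [blackSet, Set.mem_setOf_eq, crsw_parSet_faceFlip, crsw_odd_card_filter_symmDiff]
  rw [crsw_odd_card_filter_singleton v g rfl]
  exact crsw_xor_assoc_aux _ _ _ _

/-! ## §C Exports: the three generator flips with their specifications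

Each export reads: the flip is measurable, changes `μIK` by at most the stated factor, fixes the
diagonal coins `ω.2.2.2.2`, and toggles the colour of the cell `v` iff the stated predicate holds —
for EVERY column pattern `S`. -/

/-- EXPORT 1 · row-sign flip along `T ⊆ ℤ` (factor `1`, toggles the cells `v` with `v 0 ∈ T`). [folklore] -/
theorem rowFlip_spec : ∀ T : Set ℤ, Measurable (fun ω : Ω => ((symmDiff ω.1 T, ω.2) : Ω)) ∧
    μIK.map (fun ω : Ω => ((symmDiff ω.1 T, ω.2) : Ω)) ≤ (1 : ENNReal) • μIK ∧
    (∀ ω : Ω, ((symmDiff ω.1 T, ω.2) : Ω).2.2.2.2 = ω.2.2.2.2) ∧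
    ∀ (S : Set ℤ) (ω : Ω) (v : Site 2), v ∈ blackSet S ((symmDiff ω.1 T, ω.2) : Ω) ↔ Xor (v ∈ blackSet S ω) (v 0 ∈ T) := by
  intro T
  refine ⟨(crsw_measurable_symmDiff_right T).prodMap measurable_id, ?_, fun _ => rfl,
    fun S => crsw_mem_blackSet_rowFlip S T⟩
  have h := crsw_map_prodMap_le (ν := (sitePercolation ℤ half).prod
      ((sitePercolation (Site 2) (Set.projIcc (0 : ℝ) 1 zero_le_one (2 * Real.sqrt 3 - 3))).prod
        ((sitePercolation (Site 2) half).prod (sitePercolation (Site 2) half))))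
    (crsw_measurable_symmDiff_right T) measurable_id
    (crsw_map_le_one_smul_of_eq (crsw_sitePercolation_half_map_symmDiff (V := ℤ) T))
    (crsw_map_le_one_smul_of_eq Measure.map_id)
  rwa [one_mul] at h

/-- EXPORT 2 · column-sign flip along `T ⊆ ℤ` (factor `1`, toggles the cells `v` with `v 1 ∈ T`). [folklore] -/
theorem colFlip_spec (T : Set ℤ) :
    Measurable (fun ω : Ω => ((ω.1, ω.2.1 ∆ T, ω.2.2) : Ω)) ∧
    μIK.map (fun ω : Ω => ((ω.1, ω.2.1 ∆ T, ω.2.2) : Ω)) ≤ (1 : ℝ≥0∞) • μIK ∧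
    (∀ ω : Ω, ((ω.1, ω.2.1 ∆ T, ω.2.2) : Ω).2.2.2.2 = ω.2.2.2.2) ∧
    ∀ (S : Set ℤ) (ω : Ω) (v : Site 2),
      v ∈ blackSet S ((ω.1, ω.2.1 ∆ T, ω.2.2) : Ω) ↔ Xor (v ∈ blackSet S ω) (v 1 ∈ T) := by
  refine ⟨measurable_id.prodMap ((crsw_measurable_symmDiff_right T).prodMap measurable_id), ?_,
    fun _ => rfl, fun S => crsw_mem_blackSet_colFlip S T⟩
  have h2 := crsw_map_prodMap_le
    (ν := (sitePercolation (Site 2) (Set.projIcc (0 : ℝ) 1 zero_le_one (2 * Real.sqrt 3 - 3))).prod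
        ((sitePercolation (Site 2) half).prod (sitePercolation (Site 2) half)))
    (crsw_measurable_symmDiff_right T) measurable_id
    (crsw_map_le_one_smul_of_eq (crsw_sitePercolation_half_map_symmDiff (V := ℤ) T))
    (crsw_map_le_one_smul_of_eq Measure.map_id)
  have h := crsw_map_prodMap_le (μ := sitePercolation ℤ half) measurable_id
    ((crsw_measurable_symmDiff_right T).prodMap measurable_id) (crsw_map_le_one_smul_of_eq Measure.map_id) h2
  rwa [one_mul, one_mul] at h

/-- EXPORT 3 · plaquette flip at the face `g` (factor `min(q,1-q)⁻¹ < ∞`, `q = 2√3 - 3`; toggles the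
cells whose anchoring rectangle contains `g`). [folklore] -/
theorem faceFlip_spec (g : Site 2) :
    Measurable (fun ω : Ω => ((ω.1, ω.2.1, ω.2.2.1 ∆ {g}, ω.2.2.2.1 ∆ {g}, ω.2.2.2.2) : Ω)) ∧
    μIK.map (fun ω : Ω => ((ω.1, ω.2.1, ω.2.2.1 ∆ {g}, ω.2.2.2.1 ∆ {g}, ω.2.2.2.2) : Ω)) ≤
      (ENNReal.ofReal (min ((Set.projIcc (0 : ℝ) 1 zero_le_one (2 * Real.sqrt 3 - 3) : ℝ))
        (1 - (Set.projIcc (0 : ℝ) 1 zero_le_one (2 * Real.sqrt 3 - 3) : ℝ))))⁻¹ • μIK ∧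
    (∀ ω : Ω, ((ω.1, ω.2.1, ω.2.2.1 ∆ {g}, ω.2.2.2.1 ∆ {g}, ω.2.2.2.2) : Ω).2.2.2.2 = ω.2.2.2.2) ∧
    ∀ (S : Set ℤ) (ω : Ω) (v : Site 2),
      v ∈ blackSet S ((ω.1, ω.2.1, ω.2.2.1 ∆ {g}, ω.2.2.2.1 ∆ {g}, ω.2.2.2.2) : Ω) ↔
        Xor (v ∈ blackSet S ω)
          ((min 0 (v 0) ≤ g 0 ∧ g 0 < max 0 (v 0)) ∧ (min 0 (v 1) ≤ g 1 ∧ g 1 < max 0 (v 1))) := by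
  refine ⟨measurable_id.prodMap (measurable_id.prodMap ((crsw_measurable_symmDiff_right {g}).prodMap
      ((crsw_measurable_symmDiff_right {g}).prodMap measurable_id))), ?_, fun _ => rfl,
    fun S => crsw_mem_blackSet_faceFlip S g⟩
  have h45 := crsw_map_prodMap_le (μ := sitePercolation (Site 2) half) (ν := sitePercolation (Site 2) half)
    (crsw_measurable_symmDiff_right {g}) measurable_id
    (crsw_map_le_one_smul_of_eq (crsw_sitePercolation_half_map_symmDiff (V := Site 2) {g}))
    (crsw_map_le_one_smul_of_eq Measure.map_id)
  have h345 := crsw_map_prodMap_le (crsw_measurable_symmDiff_right {g})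
    ((crsw_measurable_symmDiff_right {g}).prodMap measurable_id)
    (crsw_sitePercolation_map_flip_le _ crsw_qIK_min_pos g) h45
  have h2345 := crsw_map_prodMap_le (μ := sitePercolation ℤ half) measurable_id
    ((crsw_measurable_symmDiff_right {g}).prodMap ((crsw_measurable_symmDiff_right {g}).prodMap measurable_id))
    (crsw_map_le_one_smul_of_eq Measure.map_id) h345
  have h := crsw_map_prodMap_le (μ := sitePercolation ℤ half) measurable_id
    (measurable_id.prodMap ((crsw_measurable_symmDiff_right {g}).prodMap
      ((crsw_measurable_symmDiff_right {g}).prodMap measurable_id)))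
    (crsw_map_le_one_smul_of_eq Measure.map_id) h2345
  simp only [one_mul, mul_one] at h
  exact h

/-- The plaquette factor is finite. [folklore] -/
theorem faceFlip_factor_ne_top :
    (ENNReal.ofReal (min ((Set.projIcc (0 : ℝ) 1 zero_le_one (2 * Real.sqrt 3 - 3) : ℝ))
        (1 - (Set.projIcc (0 : ℝ) 1 zero_le_one (2 * Real.sqrt 3 - 3) : ℝ))))⁻¹ ≠ ∞ :=
  ENNReal.inv_ne_top.2 ((ENNReal.ofReal_pos.2 crsw_qIK_min_pos).ne')

end Summit.CriticalPhenomena.CardyFormulaZ2.Theorems.IKLinearTransport.PinnedDiagramExchange
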